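import Mathlib

/-!
# Crux `DiophantineDichotomy.KhovanskiiApproxTypeEv` (stmt-Schanuel-14972), line `Sketch` — stub `stub_pairSumCoeffBound`

The MAHLER-MEASURE HEIGHT BOUND for the complex polynomial
`S = lead(P)^{deg Q} · ∏_{P(a)=0} Q(X − a)` attached to two non-zero integer polynomials `P, Q`
(the complex image of the resultant `Res_Y(P(Y), Q(X − Y))` annihilating `α + β`):
`‖coeffₙ S‖ ≤ 4^{pq} ((q+1)B)^p ((p+1)A)^q` where `p = deg P`, `q = deg Q` and `A, B` bound the
coefficients of `P, Q`.  Proof: `‖coeffₙ S‖ ≤ C(deg S, n) M(S) ≤ 2^{pq} M(S)`;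
`M(S) = |a|^q ∏ᵢ M(Q(X − aᵢ))`; `Q(X − aᵢ) = b ∏ⱼ (X − (aᵢ + bⱼ))` so
`M(Q(X − aᵢ)) = |b| ∏ⱼ max(1,|aᵢ + bⱼ|) ≤ 2^q max(1,|aᵢ|)^q M(Q)`; `|a|^q ∏ᵢ max(1,|aᵢ|)^q = M(P)^q`;
`M ≤ ℓ¹-norm ≤ (deg+1)·height` (all in `Mathlib.Analysis.Polynomial.MahlerMeasure`).
-/

noncomputable section

set_option linter.dupNamespace false
-- mandated summit/sub-problem namespace (single-conjunct summit)

namespace Summit.Schanuel.Schanuel.Cruxes.KhovanskiiApproxTypeEv.AnchoredReduction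

open Polynomial

/-- `max 1 ‖r + t‖ ≤ 2 · max 1 ‖r‖ · max 1 ‖t‖`. [folklore] -/
theorem max_one_norm_add_le (r t : ℂ) : max 1 ‖r + t‖ ≤ 2 * max 1 ‖r‖ * max 1 ‖t‖ := by
  have hr : 1 ≤ max 1 ‖r‖ := le_max_left _ _
  have ht : 1 ≤ max 1 ‖t‖ := le_max_left _ _
  refine max_le ?_ ?_
  · nlinarith
  · calc ‖r + t‖ ≤ ‖r‖ + ‖t‖ := norm_add_le r t
      _ ≤ max 1 ‖r‖ + max 1 ‖t‖ := add_le_add (le_max_right _ _) (le_max_right _ _)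
      _ ≤ 2 * max 1 ‖r‖ * max 1 ‖t‖ := by nlinarith

/-- Over `ℂ`, `Q(X − r) = lead(Q) · ∏_{Q(t)=0} (X − (r + t))`. [folklore] -/
theorem comp_X_sub_C_eq_C_mul_prod (Q : ℂ[X]) (r : ℂ) :
    Q.comp (X - C r) = C Q.leadingCoeff * (Q.roots.map (fun t => X - C (r + t))).prod := by
  have hroots : Multiset.card Q.roots = Q.natDegree :=
    (IsAlgClosed.splits Q).natDegree_eq_card_roots.symm
  conv_lhs => rw [← C_leadingCoeff_mul_prod_multiset_X_sub_C hroots]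
  rw [mul_comp, C_comp, multiset_prod_comp, Multiset.map_map]
  congr 2
  refine Multiset.map_congr rfl ?_
  intro t _
  simp only [Function.comp_apply, sub_comp, X_comp, C_comp, C_add]
  ring

/-- Mahler measure of a translate: `M(Q(X − r)) ≤ (2 · max 1 ‖r‖)^{deg Q} · M(Q)`. [folklore] -/
theorem mahlerMeasure_comp_X_sub_C_le (Q : ℂ[X]) (r : ℂ) :
    (Q.comp (X - C r)).mahlerMeasure ≤ (2 * max 1 ‖r‖) ^ Q.natDegree * Q.mahlerMeasure := by
  have hroots : Multiset.card Q.roots = Q.natDegree :=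
    (IsAlgClosed.splits Q).natDegree_eq_card_roots.symm
  have h1 : (Q.comp (X - C r)).mahlerMeasure =
      ‖Q.leadingCoeff‖ * (Q.roots.map (fun t => max 1 ‖r + t‖)).prod := by
    rw [comp_X_sub_C_eq_C_mul_prod Q r, mahlerMeasure_mul, mahlerMeasure_const,
      prod_mahlerMeasure_eq_mahlerMeasure_prod, Multiset.map_map]
    congr 2
    refine Multiset.map_congr rfl ?_
    intro t _
    simp only [Function.comp_apply, mahlerMeasure_X_sub_C]
  have h2 : (Q.roots.map (fun t => max 1 ‖r + t‖)).prod ≤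
      (Q.roots.map (fun t => 2 * max 1 ‖r‖ * max 1 ‖t‖)).prod :=
    Multiset.prod_map_le_prod_map₀ _ _ (fun t _ => by positivity)
      (fun t _ => max_one_norm_add_le r t)
  have h3 : (Q.roots.map (fun t => 2 * max 1 ‖r‖ * max 1 ‖t‖)).prod =
      (2 * max 1 ‖r‖) ^ Q.natDegree * (Q.roots.map (fun t => max 1 ‖t‖)).prod := by
    rw [Multiset.prod_map_mul, Multiset.map_const', Multiset.prod_replicate, hroots]
  calc (Q.comp (X - C r)).mahlerMeasure
        = ‖Q.leadingCoeff‖ * (Q.roots.map (fun t => max 1 ‖r + t‖)).prod := h1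
    _ ≤ ‖Q.leadingCoeff‖ *
          ((2 * max 1 ‖r‖) ^ Q.natDegree * (Q.roots.map (fun t => max 1 ‖t‖)).prod) := by
        gcongr
        exact h2.trans h3.le
    _ = (2 * max 1 ‖r‖) ^ Q.natDegree * Q.mahlerMeasure := by
        rw [mahlerMeasure_eq_leadingCoeff_mul_prod_roots]; ring

/-- `M(P ⊗ ℂ) ≤ (deg P + 1) · A` for an integer polynomial `P` with coefficients bounded by `A`
(Mahler measure ≤ ℓ¹-norm). [folklore] -/
theorem mahlerMeasure_map_le_of_coeff_le (P : ℤ[X]) (A : ℕ) (hA : ∀ k, |P.coeff k| ≤ (A : ℤ)) :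
    (P.map (Int.castRingHom ℂ)).mahlerMeasure ≤ ((P.natDegree : ℝ) + 1) * A := by
  have hdeg : (P.map (Int.castRingHom ℂ)).natDegree = P.natDegree :=
    natDegree_map_eq_of_injective (Int.castRingHom ℂ).injective_int P
  calc (P.map (Int.castRingHom ℂ)).mahlerMeasure
        ≤ (P.map (Int.castRingHom ℂ)).sum fun _ a => ‖a‖ := mahlerMeasure_le_sum_norm_coeff _
    _ = ∑ i ∈ Finset.range ((P.map (Int.castRingHom ℂ)).natDegree + 1),
          ‖(P.map (Int.castRingHom ℂ)).coeff i‖ := by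
        rw [sum_over_range]
        intro n
        exact norm_zero
    _ ≤ ∑ _i ∈ Finset.range ((P.map (Int.castRingHom ℂ)).natDegree + 1), (A : ℝ) := by
        refine Finset.sum_le_sum ?_
        intro i _
        rw [coeff_map, eq_intCast, Complex.norm_intCast, ← Int.cast_abs]
        exact_mod_cast hA i
    _ = ((P.natDegree : ℝ) + 1) * A := by
        rw [Finset.sum_const, Finset.card_range, hdeg, nsmul_eq_mul]
        push_cast
        ring

/-- The Mahler measure of `S = lead(P)^{deg Q} · ∏_{P(a)=0} Q(X − a)` over `ℂ`:
`M(S) ≤ 2^{pq} · M(Q)^p · M(P)^q`. [folklore] -/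
theorem mahlerMeasure_pairSum_le (P Q : ℂ[X]) :
    (C (P.leadingCoeff ^ Q.natDegree) *
        (P.roots.map (fun a => Q.comp (X - C a))).prod).mahlerMeasure ≤
      2 ^ (P.natDegree * Q.natDegree) *
        (Q.mahlerMeasure ^ P.natDegree * P.mahlerMeasure ^ Q.natDegree) := by
  have hrootsP : Multiset.card P.roots = P.natDegree :=
    (IsAlgClosed.splits P).natDegree_eq_card_roots.symm
  have hS : (C (P.leadingCoeff ^ Q.natDegree) *
        (P.roots.map (fun a => Q.comp (X - C a))).prod).mahlerMeasure =
      ‖P.leadingCoeff‖ ^ Q.natDegree *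
        (P.roots.map (fun r => (Q.comp (X - C r)).mahlerMeasure)).prod := by
    rw [mahlerMeasure_mul, mahlerMeasure_const, norm_pow, prod_mahlerMeasure_eq_mahlerMeasure_prod,
      Multiset.map_map]
    rfl
  have hle : (P.roots.map (fun r => (Q.comp (X - C r)).mahlerMeasure)).prod ≤
      (P.roots.map (fun r => (2 * max 1 ‖r‖) ^ Q.natDegree * Q.mahlerMeasure)).prod :=
    Multiset.prod_map_le_prod_map₀ _ _ (fun r _ => mahlerMeasure_nonneg _)
      (fun r _ => mahlerMeasure_comp_X_sub_C_le Q r)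
  have heq : (P.roots.map (fun r => (2 * max 1 ‖r‖) ^ Q.natDegree * Q.mahlerMeasure)).prod =
      2 ^ (P.natDegree * Q.natDegree) * (P.roots.map (fun r => max 1 ‖r‖)).prod ^ Q.natDegree *
        Q.mahlerMeasure ^ P.natDegree := by
    rw [Multiset.prod_map_mul, Multiset.prod_map_pow, Multiset.prod_map_mul, Multiset.map_const',
      Multiset.prod_replicate, Multiset.map_const', Multiset.prod_replicate, hrootsP, mul_pow,
      ← pow_mul]
  calc _ = ‖P.leadingCoeff‖ ^ Q.natDegree *
        (P.roots.map (fun r => (Q.comp (X - C r)).mahlerMeasure)).prod := hS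
    _ ≤ ‖P.leadingCoeff‖ ^ Q.natDegree *
        (2 ^ (P.natDegree * Q.natDegree) * (P.roots.map (fun r => max 1 ‖r‖)).prod ^ Q.natDegree *
          Q.mahlerMeasure ^ P.natDegree) := by
        rw [← heq]
        gcongr
    _ = 2 ^ (P.natDegree * Q.natDegree) * (Q.mahlerMeasure ^ P.natDegree *
          (‖P.leadingCoeff‖ * (P.roots.map (fun r => max 1 ‖r‖)).prod) ^ Q.natDegree) := by
        ring
    _ = 2 ^ (P.natDegree * Q.natDegree) *
          (Q.mahlerMeasure ^ P.natDegree * P.mahlerMeasure ^ Q.natDegree) := by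
        rw [← mahlerMeasure_eq_leadingCoeff_mul_prod_roots]

/-- The degree of `S = lead(P)^{deg Q} · ∏_{P(a)=0} Q(X − a)` over `ℂ` is at most `pq`. [folklore] -/
theorem natDegree_pairSum_le (P Q : ℂ[X]) :
    (C (P.leadingCoeff ^ Q.natDegree) *
        (P.roots.map (fun a => Q.comp (X - C a))).prod).natDegree ≤ P.natDegree * Q.natDegree := by
  have hrootsP : Multiset.card P.roots = P.natDegree :=
    (IsAlgClosed.splits P).natDegree_eq_card_roots.symm
  calc _ ≤ ((P.roots.map (fun a => Q.comp (X - C a))).prod).natDegree := natDegree_C_mul_le _ _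
    _ ≤ ((P.roots.map (fun a => Q.comp (X - C a))).map natDegree).sum :=
        natDegree_multiset_prod_le _
    _ = (P.roots.map (fun _ => Q.natDegree)).sum := by
        rw [Multiset.map_map]
        congr 1
        refine Multiset.map_congr rfl ?_
        intro a _
        simp only [Function.comp_apply, natDegree_comp, natDegree_X_sub_C, mul_one]
    _ = P.natDegree * Q.natDegree := by
        rw [Multiset.map_const', Multiset.sum_replicate, hrootsP, smul_eq_mul]

/-- SUB-GOAL (worker): the MAHLER-MEASURE HEIGHT BOUND for
`S = lead(P)^{deg Q} · ∏_{P(a)=0} Q(X − a)`: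
`|coeff S| ≤ 4^{pq} ((q+1)B)^p ((p+1)A)^q` where `p = deg P`, `q = deg Q`, `A, B` bound the coefficients of `P, Q`
(`|coeffₙ S| ≤ C(pq, n) M(S) ≤ 2^{pq} M(S)`; `M(S) = |a|^q ∏ᵢ M(Q(X − aᵢ))`; `Q(X − aᵢ) = b ∏ⱼ (X − (aᵢ + bⱼ))` so
`M(Q(X − aᵢ)) = |b| ∏ⱼ max(1,|aᵢ + bⱼ|) ≤ 2^q max(1,|aᵢ|)^q M(Q)`; `|a|^q ∏ᵢ max(1,|aᵢ|)^q = M(P)^q`; `M ≤ ℓ¹-norm ≤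
(deg+1)·height`; all in `Mathlib.Analysis.Polynomial.MahlerMeasure`). [folklore] -/
theorem stub_pairSumCoeffBound (P Q : Polynomial ℤ) (hP : P ≠ 0) (hQ : Q ≠ 0) (A B : ℕ)
    (hA : ∀ k, |P.coeff k| ≤ (A : ℤ)) (hB : ∀ k, |Q.coeff k| ≤ (B : ℤ)) :
    let S : Polynomial ℂ := Polynomial.C ((P.map (Int.castRingHom ℂ)).leadingCoeff ^ Q.natDegree) *
        ((P.map (Int.castRingHom ℂ)).roots.map
          (fun a => (Q.map (Int.castRingHom ℂ)).comp (Polynomial.X - Polynomial.C a))).prod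
    ∀ n, ‖S.coeff n‖ ≤ (4 : ℝ) ^ (P.natDegree * Q.natDegree) *
        (((Q.natDegree : ℝ) + 1) * B) ^ P.natDegree * (((P.natDegree : ℝ) + 1) * A) ^ Q.natDegree := by
  intro S n
  have hinj : Function.Injective (Int.castRingHom ℂ) := (Int.castRingHom ℂ).injective_int
  have hdegP : (P.map (Int.castRingHom ℂ)).natDegree = P.natDegree :=
    natDegree_map_eq_of_injective hinj P
  have hdegQ : (Q.map (Int.castRingHom ℂ)).natDegree = Q.natDegree :=
    natDegree_map_eq_of_injective hinj Q
  -- the Mahler measures of `P ⊗ ℂ`, `Q ⊗ ℂ` are at least `1` (non-zero integer polynomials; this is the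
  -- only use of `hP`, `hQ` — for zero polynomials the bound holds trivially) and at most `(deg + 1) · height`
  have hP0 : 0 ≤ (P.map (Int.castRingHom ℂ)).mahlerMeasure :=
    zero_le_one.trans (one_le_mahlerMeasure_of_ne_zero hP)
  have hQ0 : 0 ≤ (Q.map (Int.castRingHom ℂ)).mahlerMeasure :=
    zero_le_one.trans (one_le_mahlerMeasure_of_ne_zero hQ)
  have hMP : (P.map (Int.castRingHom ℂ)).mahlerMeasure ^ Q.natDegree ≤
      (((P.natDegree : ℝ) + 1) * A) ^ Q.natDegree :=
    pow_le_pow_left₀ hP0 (mahlerMeasure_map_le_of_coeff_le P A hA) _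
  have hMQ : (Q.map (Int.castRingHom ℂ)).mahlerMeasure ^ P.natDegree ≤
      (((Q.natDegree : ℝ) + 1) * B) ^ P.natDegree :=
    pow_le_pow_left₀ hQ0 (mahlerMeasure_map_le_of_coeff_le Q B hB) _
  have hSdeg : S.natDegree ≤ P.natDegree * Q.natDegree := by
    have h := natDegree_pairSum_le (P.map (Int.castRingHom ℂ)) (Q.map (Int.castRingHom ℂ))
    rw [hdegP, hdegQ] at h
    exact h
  have hMS : S.mahlerMeasure ≤ 2 ^ (P.natDegree * Q.natDegree) *
      ((Q.map (Int.castRingHom ℂ)).mahlerMeasure ^ P.natDegree *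
        (P.map (Int.castRingHom ℂ)).mahlerMeasure ^ Q.natDegree) := by
    have h := mahlerMeasure_pairSum_le (P.map (Int.castRingHom ℂ)) (Q.map (Int.castRingHom ℂ))
    rw [hdegP, hdegQ] at h
    exact h
  have h1 : ‖S.coeff n‖ ≤ (S.natDegree.choose n) * S.mahlerMeasure :=
    norm_coeff_le_choose_mul_mahlerMeasure n S
  have h2 : ((S.natDegree.choose n : ℕ) : ℝ) ≤ 2 ^ (P.natDegree * Q.natDegree) :=
    calc ((S.natDegree.choose n : ℕ) : ℝ) ≤ 2 ^ S.natDegree := by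
          exact_mod_cast Nat.choose_le_two_pow _ _
      _ ≤ 2 ^ (P.natDegree * Q.natDegree) := pow_le_pow_right₀ (by norm_num) hSdeg
  calc ‖S.coeff n‖ ≤ (S.natDegree.choose n) * S.mahlerMeasure := h1
    _ ≤ 2 ^ (P.natDegree * Q.natDegree) * (2 ^ (P.natDegree * Q.natDegree) *
          ((Q.map (Int.castRingHom ℂ)).mahlerMeasure ^ P.natDegree *
            (P.map (Int.castRingHom ℂ)).mahlerMeasure ^ Q.natDegree)) :=
        mul_le_mul h2 hMS (mahlerMeasure_nonneg _) (by positivity)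
    _ ≤ 2 ^ (P.natDegree * Q.natDegree) * (2 ^ (P.natDegree * Q.natDegree) *
          ((((Q.natDegree : ℝ) + 1) * B) ^ P.natDegree *
            (((P.natDegree : ℝ) + 1) * A) ^ Q.natDegree)) :=
        mul_le_mul_of_nonneg_left (mul_le_mul_of_nonneg_left
          (mul_le_mul hMQ hMP (pow_nonneg hP0 _) (by positivity)) (by positivity)) (by positivity)
    _ = (4 : ℝ) ^ (P.natDegree * Q.natDegree) *
        (((Q.natDegree : ℝ) + 1) * B) ^ P.natDegree * (((P.natDegree : ℝ) + 1) * A) ^ Q.natDegree := by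
        have h4 : (4 : ℝ) ^ (P.natDegree * Q.natDegree) =
            2 ^ (P.natDegree * Q.natDegree) * 2 ^ (P.natDegree * Q.natDegree) := by
          rw [← mul_pow]
          norm_num
        rw [h4]
        ring

end Summit.Schanuel.Schanuel.Cruxes.KhovanskiiApproxTypeEv.AnchoredReduction

end
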